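import Literature.AlgebraicGeometry.Motives.SepQuotientPieces
import Literature.AlgebraicGeometry.Morphisms.CofanPieceMapFamily
import HarnessLib

/-!
# A finite group acting on a coproduct of connected schemes PERMUTES the pieces; for a quotient it is transitive on the pieces
# over each piece of the quotient, and under piecewise rigidity the piece group is the stabiliser (SGA 1 V §1; Görtz–Wedhorn I §(3.5))

Topic `AlgebraicGeometry/Motives`; namespaces `Literature.AlgebraicGeometry.Morphisms` (§1, any base) and
`Literature.AlgebraicGeometry.Motives` (§2–§3, over `ℂ`).  THEOREMS ONLY (no definition, no named fact, no instance, no `sorry`).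
Sequel of ★ `CofanPieceMapFamily` (piece maps of a family of morphisms, composites, identities) and ★ `SepQuotientPieces` (fibres
of a quotient `p : X → Y = X/Δ` are orbits; piece maps are onto; the piece group `H ≤ Aut (Xp j)` of lifts of the stabiliser).

* §1 `Over.exists_piecePerm` — for a colimit cofan `ιX : Xp j ⟶ X` of non-empty preconnected pieces and `act : Δ →* Aut X`, there is
  a PERMUTATION REPRESENTATION `ρ : Δ →* Equiv.Perm σ′` with lifts `dk δ j : Xp j ⟶ Xp (ρ δ j)`, `dk δ j ≫ ιX (ρ δ j) = ιX j ≫ act δ`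
  (the index maps of ★ `Over.exists_pieceMap_family` are multiplicative by ★ `Over.pieceMap_index_eq_comp` / `…_eq_self_of_id`,
  hence bijective).  This is the `[MulAction Δ C″]` / `dk` / `hdk` input of the deck-invariance lemmas of the Liu Appendix C glue
  (`MulAction.compHom _ ρ`).
* §2 `piecePerm_transitive_of_isSepQuotient` — for a quotient `p : X ⟶ Y` by `act` (separated test objects; `X` projective, pieces
  integral) with piece maps `tq j : Xp j ⟶ Yp (r j)`, the group `Δ` is TRANSITIVE on the fibres of `r`: `r j₁ = r j₂ → ∃ δ, ρ δ j₁ = j₂`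
  (★ `surjective_map_pieceMap`, ★ `IsSepQuotient.exists_map_act_eq_of_map_eq`, ★ `pieceIndex_unique`).
* §3 `card_pieceGroup_eq_card_stabilizer` — if no non-trivial `δ` restricts to the identity on the piece `Xp j` («piecewise
  rigidity», `ιX j ≫ act δ = ιX j → δ = 1`), the piece group `H ≤ Aut (Xp j)` of ★ `exists_subgroup_isSepQuotient_pieceMap′` is in
  bijection with the stabiliser `{δ | ρ δ j = j}`; `exists_subgroup_isSepQuotient_pieceMap_card` packages §3 with ★ §4 of
  `SepQuotientPieces`.

Cell `hodgecm-mathlib` (D-0151), crux `HLiu418` = stmt-HodgeConjecture-24832, d6 line, `stub_RosH` glue, (G4Σ) Layer 2: the raw weight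
`#H_q` of ★ `Jacobian.exists_entry_package` equals the stabiliser weight of ★ `transposedWord_package_of_bricks_of_stabilizer` under the
(PF) rigidity of the tower.  Count-neutral; HC_CM is proved only modulo the 7 printed citations until rung 0 closes.

## References
* [SGA1] A. Grothendieck, M. Raynaud, *SGA 1*, Exp. V §1, Prop. 1.1 (fibres = orbits), Prop. 1.8.
* [GortzWedhorn2020] U. Görtz, T. Wedhorn, *Algebraic Geometry I* (2nd ed.), §(3.5) Prop. 3.10, Example 3.11 (p. 73), Lemma 1.19 (1).
* [MumfordAV1970] D. Mumford, *Abelian Varieties* (1970), §7 Thm. p. 66 (1), (2) and Remark.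
-/

set_option autoImplicit false

noncomputable section

open CategoryTheory CategoryTheory.Limits AlgebraicGeometry

/-! ## §1 The permutation representation on the pieces -/

namespace Literature.AlgebraicGeometry.Morphisms

universe v u

section Perm

variable {σ : Type v} [Small.{u} σ] {B : Scheme.{u}} {X : σ → Over B} {S : Over B} {f : ∀ i, X i ⟶ S}

/-- **A group of automorphisms of a coproduct PERMUTES the pieces.**  For a colimit cofan `(f_j : X_j ⟶ S)` in `Over B` with non-empty
preconnected pieces and a homomorphism `act : Δ →* Aut S`, there are a permutation representation `ρ : Δ →* Equiv.Perm σ` and lifts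
`dk δ j : X_j ⟶ X_{ρ δ j}` with `dk δ j ≫ f_{ρ δ j} = f_j ≫ act δ` — the index maps of ★ `Over.exists_pieceMap_family` satisfy
`φ 1 = id` (★ `Over.pieceMap_index_eq_self_of_id`) and `φ (δ₁δ₂) = φ δ₁ ∘ φ δ₂` (★ `Over.pieceMap_index_eq_comp`; `(δ₁δ₂).hom = δ₂.hom ≫ δ₁.hom`
in `Aut`), so each `φ δ` is a bijection with inverse `φ δ⁻¹`. [cite: GortzWedhorn2020, Lemma 1.19 (1) (§(1.5)) with §(3.5) Example 3.11 (p. 73)] -/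
theorem Over.exists_piecePerm (hc : IsColimit (Cofan.mk S f)) [∀ j, PreconnectedSpace (X j).left] [∀ j, Nonempty (X j).left]
    {Δ : Type*} [Group Δ] (act : Δ →* Aut S) :
    ∃ (ρ : Δ →* Equiv.Perm σ) (dk : ∀ (δ : Δ) (j : σ), X j ⟶ X (ρ δ j)), ∀ δ j, dk δ j ≫ f (ρ δ j) = f j ≫ (act δ).hom := by
  obtain ⟨φ, t, ht⟩ := Over.exists_pieceMap_family hc f (fun δ : Δ => (act δ).hom)
  have h1 : ∀ j, φ 1 j = j := fun j =>
    Over.pieceMap_index_eq_self_of_id hc (t 1 j) (by rw [ht, map_one]; rfl)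
  have hmul : ∀ δ₁ δ₂ j, φ (δ₁ * δ₂) j = φ δ₁ (φ δ₂ j) := fun δ₁ δ₂ j =>
    Over.pieceMap_index_eq_comp hc (t δ₂) (ht δ₂) (t δ₁) (ht δ₁) (t (δ₁ * δ₂) j) (by rw [ht, map_mul]; rfl)
  let ρ : Δ →* Equiv.Perm σ :=
    { toFun := fun δ => ⟨φ δ, φ δ⁻¹, fun j => by rw [← hmul, inv_mul_cancel, h1], fun j => by rw [← hmul, mul_inv_cancel, h1]⟩
      map_one' := Equiv.ext fun j => h1 j
      map_mul' := fun δ₁ δ₂ => Equiv.ext fun j => hmul δ₁ δ₂ j }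
  exact ⟨ρ, t, ht⟩

/-- **The same for irreducible pieces** (an irreducible space is non-empty and preconnected).
[cite: GortzWedhorn2020, Lemma 1.19 (1) (§(1.5)) with §(3.5) Example 3.11 (p. 73)] -/
theorem Over.exists_piecePerm_of_irreducibleSpace (hc : IsColimit (Cofan.mk S f)) [∀ j, IrreducibleSpace (X j).left]
    {Δ : Type*} [Group Δ] (act : Δ →* Aut S) :
    ∃ (ρ : Δ →* Equiv.Perm σ) (dk : ∀ (δ : Δ) (j : σ), X j ⟶ X (ρ δ j)), ∀ δ j, dk δ j ≫ f (ρ δ j) = f j ≫ (act δ).hom :=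
  haveI : ∀ j, Nonempty (X j).left := fun _ => IrreducibleSpace.toNonempty
  Over.exists_piecePerm hc act

end Perm

end Literature.AlgebraicGeometry.Morphisms

/-! ## §2 A quotient: the group is transitive on the pieces over each piece of the quotient -/

namespace Literature.AlgebraicGeometry.Motives

open Literature.AlgebraicGeometry.Morphisms

section Quotient

variable {Δ : Type} [Group Δ] [Finite Δ] {X Y : SchemeOver ℂ} (act : Δ →* Aut X) (p : X ⟶ Y)
  {σ σ' : Type} [Fintype σ'] {Xp : σ' → SchemeOver ℂ} (ιX : ∀ j, Xp j ⟶ X) {Yp : σ → SchemeOver ℂ} (ιY : ∀ i, Yp i ⟶ Y)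

/-- **The deck group is transitive on the pieces of `X` over each piece of `Y = X/Δ`.**  Let `p : X ⟶ Y` be a quotient of the
projective `X` by the finite `Δ` for separated test objects (`Y` separated), `X = ∐ Xp j` (integral projective pieces with complex
points), `Y = ∐ Yp i` (integral separated pieces), `tq j : Xp j ⟶ Yp (r j)` the piece maps over `p`, and `(ρ, dk)` the permutation of
the pieces by `act` (§1).  If `r j₁ = r j₂` then `ρ δ j₁ = j₂` for some `δ`: a point `P₁` of `Xp j₁` and — the piece map of `j₂` being ONTO
(★ `surjective_map_pieceMap`) — a point `P₂` of `Xp j₂` over the same point of `Y` differ by some `act δ` (★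
`IsSepQuotient.exists_map_act_eq_of_map_eq`), and `act δ` carries the piece `j₁` to the piece containing `act δ · P₁ = P₂` (★ `pieceIndex_unique`).
[cite: SGA1, Exp. V §1, Prop. 1.1] [cite: GortzWedhorn2020, §(3.5) Proposition 3.10 and Example 3.11 (p. 73)] -/
theorem piecePerm_transitive_of_isSepQuotient (hX : IsProjectiveOver X) (hY : IsSeparated Y.hom)
    (hp : IsSepQuotient (fun g => act g) p)
    (hcX : IsColimit (Cofan.mk X ιX)) (hcY : IsColimit (Cofan.mk Y ιY))
    (hXp : ∀ j, IsProjectiveOver (Xp j)) [∀ j, IsIntegral (Xp j).left] (hpt : ∀ j, Nonempty (AlgPoints (Xp j) ℂ))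
    (hYp : ∀ i, IsSeparated (Yp i).hom) [∀ i, IsIntegral (Yp i).left]
    (r : σ' → σ) (tq : ∀ j, Xp j ⟶ Yp (r j)) (htq : ∀ j, tq j ≫ ιY (r j) = ιX j ≫ p)
    (ρ : Δ →* Equiv.Perm σ') (dk : ∀ (δ : Δ) (j : σ'), Xp j ⟶ Xp (ρ δ j))
    (hdk : ∀ δ j, dk δ j ≫ ιX (ρ δ j) = ιX j ≫ (act δ).hom)
    {j₁ j₂ : σ'} (h : r j₁ = r j₂) : ∃ δ : Δ, ρ δ j₁ = j₂ := by
  classical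
  -- a factorisation of `ιX j₁ ≫ p` through the leg of `r j₂` (fresh index, identified with `r j₁ = r j₂`)
  obtain ⟨i, s₁, hs₁⟩ : ∃ (i : σ) (s₁ : Xp j₁ ⟶ Yp i), s₁ ≫ ιY i = ιX j₁ ≫ p := ⟨r j₁, tq j₁, htq j₁⟩
  have hi : i = r j₂ := (Over.pieceMap_index_unique hcY s₁ (tq j₁) hs₁ (htq j₁)).trans h
  subst hi
  -- points: `P₁` on `Xp j₁`, `P₂` on `Xp j₂` over the same point of `Y`
  obtain ⟨P₁⟩ := hpt j₁
  obtain ⟨P₂, hP₂⟩ := surjective_map_pieceMap act p ιX ιY hX hY hp hcX hcY hXp hYp r tq htq j₂ (AlgPoints.map s₁ P₁)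
  have hpp : AlgPoints.map p (AlgPoints.map (ιX j₁) P₁) = AlgPoints.map p (AlgPoints.map (ιX j₂) P₂) := by
    rw [← AlgPoints.map_comp_apply, ← AlgPoints.map_comp_apply, ← hs₁, ← htq j₂, AlgPoints.map_comp_apply,
      AlgPoints.map_comp_apply, hP₂]
  -- they differ by some `act δ`, which therefore maps the piece `j₁` to the piece `j₂`
  obtain ⟨δ, hδ⟩ := IsSepQuotient.exists_map_act_eq_of_map_eq act p hX hY hp hpp
  refine ⟨δ, pieceIndex_unique ιX hcX (T := specOver ℂ ℂ) (q := AlgPoints.map (ιX j₂) P₂) (P₁ ≫ dk δ j₁) P₂ ?_ rfl⟩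
  rw [Category.assoc, hdk, ← hδ]
  rfl

end Quotient

/-! ## §3 Piecewise rigidity: the piece group IS the stabiliser -/

section Rigid

variable {Δ : Type} [Group Δ] {X : SchemeOver ℂ} (act : Δ →* Aut X)
  {σ' : Type} {Xp : σ' → SchemeOver ℂ} (ιX : ∀ j, Xp j ⟶ X)

/-- **Under piecewise rigidity the piece group is in bijection with the stabiliser.**  Let `(ρ, dk)` be the permutation of the pieces by
`act` (§1), `H ≤ Aut (Xp j)` a subgroup consisting of lifts of elements of `Δ` (`∀ h ∈ H, ∃ g, h.hom ≫ ιX j = ιX j ≫ act g`) and containing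
every such lift (`u ≫ ιX j = ιX j ≫ act g → ∃ h ∈ H, h.hom = u`) — the piece group of ★ `exists_subgroup_isSepQuotient_pieceMap′` —, and
assume PIECEWISE RIGIDITY at `j`: `ιX j ≫ act δ = ιX j → δ = 1` (no non-trivial `δ` restricts to the identity of the piece; for Shimura
curves: a Hecke translate trivial on one complex component is trivial).  Then `δ ↦ (its lift through Xp j)` is a bijection
`{δ | ρ δ j = j} ≃ H` (injective by rigidity, surjective by ★ `pieceIndex_unique` / ★ `pieceLift_unique`), so `#H = #Stab_Δ(j)`.
[cite: SGA1, Exp. V §1, Prop. 1.8] [cite: GortzWedhorn2020, §(3.5) Proposition 3.10 and Example 3.11 (p. 73)] -/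
theorem card_pieceGroup_eq_card_stabilizer (hcX : IsColimit (Cofan.mk X ιX)) [∀ j, IsIntegral (Xp j).left]
    (ρ : Δ →* Equiv.Perm σ') (dk : ∀ (δ : Δ) (j : σ'), Xp j ⟶ Xp (ρ δ j))
    (hdk : ∀ δ j, dk δ j ≫ ιX (ρ δ j) = ιX j ≫ (act δ).hom)
    (j : σ') (H : Subgroup (Aut (Xp j)))
    (hH₁ : ∀ h ∈ H, ∃ g : Δ, h.hom ≫ ιX j = ιX j ≫ (act g).hom)
    (hH₂ : ∀ (g : Δ) (u : Xp j ⟶ Xp j), u ≫ ιX j = ιX j ≫ (act g).hom → ∃ h ∈ H, h.hom = u)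
    (hrig : ∀ δ : Δ, ιX j ≫ (act δ).hom = ιX j → δ = 1) :
    Nat.card ↥H = Nat.card {δ : Δ // ρ δ j = j} := by
  classical
  -- the lift through the piece `j` of an element of the stabiliser
  have hlift : ∀ δ : {δ : Δ // ρ δ j = j}, ∃ h : ↥H, (h : Aut (Xp j)).hom ≫ ιX j = ιX j ≫ (act δ.1).hom := by
    rintro ⟨δ, hδ⟩
    obtain ⟨j', hj', u, hu⟩ : ∃ j', j' = j ∧ ∃ u : Xp j ⟶ Xp j', u ≫ ιX j' = ιX j ≫ (act δ).hom :=
      ⟨ρ δ j, hδ, dk δ j, hdk δ j⟩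
    subst hj'
    obtain ⟨h, hh, rfl⟩ := hH₂ δ u hu
    exact ⟨⟨h, hh⟩, hu⟩
  choose Ψ hΨ using hlift
  have hinj : Function.Injective Ψ := by
    rintro ⟨δ₁, h₁⟩ ⟨δ₂, h₂⟩ heq
    have e : ιX j ≫ (act δ₁).hom = ιX j ≫ (act δ₂).hom := by rw [← hΨ ⟨δ₁, h₁⟩, ← hΨ ⟨δ₂, h₂⟩, heq]
    have h21 : δ₂⁻¹ * δ₁ = 1 := hrig _ (by
      rw [map_mul, map_inv]
      change ιX j ≫ ((act δ₁).hom ≫ (act δ₂).inv) = ιX j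
      rw [← Category.assoc, e, Category.assoc, Iso.hom_inv_id, Category.comp_id])
    exact Subtype.ext (inv_mul_eq_one.mp h21).symm
  have hsurj : Function.Surjective Ψ := by
    rintro ⟨h, hh⟩
    obtain ⟨g, hg⟩ := hH₁ h hh
    have hj : ρ g j = j := pieceIndex_unique ιX hcX (dk g j) h.hom (hdk g j) hg
    refine ⟨⟨g, hj⟩, Subtype.ext (Iso.ext ?_)⟩
    exact pieceLift_unique ιX hcX _ _ (by rw [hΨ ⟨g, hj⟩, hg])
  exact (Nat.card_congr (Equiv.ofBijective Ψ ⟨hinj, hsurj⟩)).symm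

/-- **The same in `Fintype.card` currency** (any `Fintype` instances). [cite: SGA1, Exp. V §1, Prop. 1.8] -/
theorem fintypeCard_pieceGroup_eq_card_stabilizer (hcX : IsColimit (Cofan.mk X ιX)) [∀ j, IsIntegral (Xp j).left]
    (ρ : Δ →* Equiv.Perm σ') (dk : ∀ (δ : Δ) (j : σ'), Xp j ⟶ Xp (ρ δ j))
    (hdk : ∀ δ j, dk δ j ≫ ιX (ρ δ j) = ιX j ≫ (act δ).hom)
    (j : σ') (H : Subgroup (Aut (Xp j))) [Fintype ↥H] [Fintype {δ : Δ // ρ δ j = j}]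
    (hH₁ : ∀ h ∈ H, ∃ g : Δ, h.hom ≫ ιX j = ιX j ≫ (act g).hom)
    (hH₂ : ∀ (g : Δ) (u : Xp j ⟶ Xp j), u ≫ ιX j = ιX j ≫ (act g).hom → ∃ h ∈ H, h.hom = u)
    (hrig : ∀ δ : Δ, ιX j ≫ (act δ).hom = ιX j → δ = 1) :
    Fintype.card ↥H = Fintype.card {δ : Δ // ρ δ j = j} := by
  rw [← Nat.card_eq_fintype_card, ← Nat.card_eq_fintype_card]
  exact card_pieceGroup_eq_card_stabilizer act ιX hcX ρ dk hdk j H hH₁ hH₂ hrig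

variable [Finite Δ] [Fintype σ'] {Y : SchemeOver ℂ} (p : X ⟶ Y) {σ : Type} {Yp : σ → SchemeOver ℂ} (ιY : ∀ i, Yp i ⟶ Y)

/-- **THE PIECEWISE QUOTIENT WITH ITS DEGREE under piecewise rigidity**: ★ `exists_subgroup_isSepQuotient_pieceMap′` (the piece map
`t j : Xp j ⟶ Yp (φ j)` over the quotient `p` is a quotient of `Xp j` by a finite `H ≤ Aut (Xp j)` for separated test objects) together
with `#H = #{δ | ρ δ j = j}` (`card_pieceGroup_eq_card_stabilizer`).  For the d6 glue this equates the raw weight `#H_q` of the entry pairs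
with the stabiliser weight of the transposed word. [cite: SGA1, Exp. V §1 Prop. 1.1, 1.8] [cite: MumfordAV1970, §7 Thm. p. 66 (Remark)]
[cite: GortzWedhorn2020, §(3.5) Proposition 3.10 and Example 3.11 (p. 73)] -/
theorem exists_subgroup_isSepQuotient_pieceMap_card (hX : IsProjectiveOver X) (hY : IsSeparated Y.hom)
    (hp : IsSepQuotient (fun g => act g) p)
    (hcX : IsColimit (Cofan.mk X ιX)) (hcY : IsColimit (Cofan.mk Y ιY))
    (hXp : ∀ j, IsProjectiveOver (Xp j)) [∀ j, IsIntegral (Xp j).left]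
    (hYp : ∀ i, IsSeparated (Yp i).hom) [∀ i, IsIntegral (Yp i).left] [∀ i, Smooth (Yp i).hom]
    (φ : σ' → σ) (t : ∀ j, Xp j ⟶ Yp (φ j)) (ht : ∀ j, t j ≫ ιY (φ j) = ιX j ≫ p)
    (ρ : Δ →* Equiv.Perm σ') (dk : ∀ (δ : Δ) (j : σ'), Xp j ⟶ Xp (ρ δ j))
    (hdk : ∀ δ j, dk δ j ≫ ιX (ρ δ j) = ιX j ≫ (act δ).hom)
    (j : σ') (hrig : ∀ δ : Δ, ιX j ≫ (act δ).hom = ιX j → δ = 1) :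
    ∃ H : Subgroup (Aut (Xp j)),
      Finite H ∧ IsSepQuotient (fun h : ↥H => (h : Aut (Xp j))) (t j) ∧ Nat.card ↥H = Nat.card {δ : Δ // ρ δ j = j} := by
  obtain ⟨H, hfin, hH₁, hH₂, hq⟩ := exists_subgroup_isSepQuotient_pieceMap' act p ιX ιY hX hY hp hcX hcY hXp hYp φ t ht j
  exact ⟨H, hfin, hq, card_pieceGroup_eq_card_stabilizer act ιX hcX ρ dk hdk j H hH₁ hH₂ hrig⟩

end Rigid

end Literature.AlgebraicGeometry.Motives

end
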